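import Mathlib
import Summits.Ventures.HodgeRepro2.T5WedgeRank

/-!
# T5FrameIndependence — the zero locus of `ω_{ab}` does not depend on the frame or the chart

Tier-5 support for sub-step N1 (Hodge-theoretic side; memo route/T5-N1-hodge-p6.md §H6 / §H8):
«ω_{ab} is a holomorphic section of the line bundle Ω²_{S_j}» — the identity-principle files
(`T5IdentityPrinciple`, `T5IdentityPrincipleGlobal`, `T5EmptyInterior`) speak about the scalar
coefficient of `ω_{ab}` in a local frame of `Ω²`, and the memo's prose item is that its zero locus
is frame-independent «because transition functions are units».  This file records the two
elementary facts behind that sentence, in the coefficient model of `T5WedgeRank`: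

* `zeroSet_eq_of_mul_unit`: two coefficient functions differing by a nowhere-zero factor (the
  transition function between two frames of a line bundle) have the same zero set, and one is
  identically zero on a set iff the other is;
* `wedge10_vecMul`: under a linear change of coordinates with matrix `J` the pulled-back
  covectors are `u ↦ u ᵥ* J`, and `(u ᵥ* J) ∧ (v ᵥ* J) = det J · (u ∧ v)` — the transition function
  of `Ω²` is the Jacobian determinant, a unit for an invertible chart change
  (`wedge10_vecMul_eq_zero_iff`, `wedge10_vecMul_ne_zero_iff`);
* `coeff_comp_eq_vecMul` / `wedge10_comp_eq_det_mul`: for a chart change `φ` differentiable at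
  `z`, the coefficient vectors of the pulled-back covectors `L ∘ dφ_z` are `u ᵥ* jac`, `jac` the
  Jacobian of `φ` at `z`, so the coefficient of `φ^*ω` at `z` is `det(dφ_z)` times the coefficient
  of `ω` at `φ z` — the zero locus is chart-independent where `det(dφ_z) ≠ 0`.

Blind lane (cell pub-hodge-repro2): `import Mathlib` + own `T5WedgeRank`, 0 sorry, standard axioms.
-/

namespace Summit.Ventures.HodgeRepro2.T5FrameIndependence

open Summit.Ventures.HodgeRepro2.T5WedgeRank Matrix

section Unit

variable {X : Type*}

/-- Two coefficient functions related by a nowhere-zero factor (`a = a' · u`, `u` a unit — the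
transition function between two local frames of a line bundle) have the same zero set. -/
theorem zeroSet_eq_of_mul_unit {a a' u : X → ℂ} (hu : ∀ x, u x ≠ 0) (h : ∀ x, a x = a' x * u x) :
    {x | a x = 0} = {x | a' x = 0} := by
  ext x
  simp only [Set.mem_setOf_eq, h x, mul_eq_zero, hu x, or_false]

/-- The coefficient in one frame vanishes on a set iff the coefficient in another frame does. -/
theorem eqOn_zero_iff_of_mul_unit {a a' u : X → ℂ} (hu : ∀ x, u x ≠ 0)
    (h : ∀ x, a x = a' x * u x) (U : Set X) :
    (∀ x ∈ U, a x = 0) ↔ ∀ x ∈ U, a' x = 0 := by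
  refine forall₂_congr fun x _ => ?_
  rw [h x, mul_eq_zero, or_iff_left (hu x)]

/-- The coefficient in one frame is non-zero somewhere on a set iff the coefficient in another
frame is. -/
theorem exists_ne_zero_iff_of_mul_unit {a a' u : X → ℂ} (hu : ∀ x, u x ≠ 0)
    (h : ∀ x, a x = a' x * u x) (U : Set X) :
    (∃ x ∈ U, a x ≠ 0) ↔ ∃ x ∈ U, a' x ≠ 0 := by
  refine exists_congr fun x => and_congr_right fun _ => ?_
  rw [h x, ne_eq, mul_eq_zero, or_iff_left (hu x)]

end Unit

section LinearChange

/-- The pull-back of the covector with coefficient vector `u` by the linear map with matrix `J`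
(`(J^*u)_i = Σ_k u_k J_{k i} = (u ᵥ* J)_i`): the wedge of two pulled-back covectors is
`det J` times the wedge — the transition function of `Ω²` is the Jacobian determinant. -/
theorem wedge10_vecMul (J : Matrix (Fin 2) (Fin 2) ℂ) (u v : Fin 2 → ℂ) :
    wedge10 (u ᵥ* J) (v ᵥ* J) = J.det * wedge10 u v := by
  simp only [wedge10, vecMul, dotProduct, Fin.sum_univ_two, det_fin_two]
  ring

/-- The same in the `mulVec` convention (`J *ᵥ u`). -/
theorem wedge10_mulVec (J : Matrix (Fin 2) (Fin 2) ℂ) (u v : Fin 2 → ℂ) :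
    wedge10 (J *ᵥ u) (J *ᵥ v) = J.det * wedge10 u v := by
  simp only [wedge10, mulVec, dotProduct, Fin.sum_univ_two, det_fin_two]
  ring

/-- For an invertible change of coordinates the wedge vanishes before iff after. -/
theorem wedge10_vecMul_eq_zero_iff {J : Matrix (Fin 2) (Fin 2) ℂ} (hJ : J.det ≠ 0)
    (u v : Fin 2 → ℂ) : wedge10 (u ᵥ* J) (v ᵥ* J) = 0 ↔ wedge10 u v = 0 := by
  rw [wedge10_vecMul, mul_eq_zero, or_iff_right hJ]

/-- For an invertible change of coordinates the wedge is non-zero before iff after. -/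
theorem wedge10_vecMul_ne_zero_iff {J : Matrix (Fin 2) (Fin 2) ℂ} (hJ : J.det ≠ 0)
    (u v : Fin 2 → ℂ) : wedge10 (u ᵥ* J) (v ᵥ* J) ≠ 0 ↔ wedge10 u v ≠ 0 :=
  (wedge10_vecMul_eq_zero_iff hJ u v).not

end LinearChange

section ChartChange

/-- A covector on the chart `ℂ²` is determined by its coefficient vector `k ↦ L e_k`:
`L w = Σ_k w_k · L e_k`. -/
theorem clm_apply_eq_sum (L : (Fin 2 → ℂ) →L[ℂ] ℂ) (w : Fin 2 → ℂ) :
    L w = ∑ k, w k * L (Pi.single k 1) := by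
  conv_lhs => rw [pi_eq_sum_univ' w]
  rw [map_sum]
  refine Finset.sum_congr rfl fun k _ => ?_
  rw [map_smul, smul_eq_mul]

/-- The coefficient vector of the pull-back `L ∘ D` of a covector `L` by a linear map `D` (the
differential of a chart change) is `u ᵥ* jac`, where `u` is the coefficient vector of `L` and
`jac k i = (D e_i)_k` is the matrix of `D`. -/
theorem coeff_comp_eq_vecMul (L : (Fin 2 → ℂ) →L[ℂ] ℂ) (D : (Fin 2 → ℂ) →L[ℂ] (Fin 2 → ℂ)) :
    (fun i => (L.comp D) (Pi.single i 1)) =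
      (fun k => L (Pi.single k 1)) ᵥ* (fun k i => D (Pi.single i 1) k) := by
  funext i
  simp only [ContinuousLinearMap.comp_apply, vecMul, dotProduct]
  rw [clm_apply_eq_sum L (D (Pi.single i 1))]
  exact Finset.sum_congr rfl fun k _ => mul_comm _ _

/-- The wedge of the two pulled-back covectors `L ∘ D`, `L' ∘ D` is `det(jac)` times the wedge of
`L`, `L'`: with `D = dφ_z` for a chart change `φ`, the coefficient of `φ^*ω` at `z` is the Jacobian
determinant times the coefficient of `ω` at `φ z`. -/
theorem wedge10_comp_eq_det_mul (L L' : (Fin 2 → ℂ) →L[ℂ] ℂ)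
    (D : (Fin 2 → ℂ) →L[ℂ] (Fin 2 → ℂ)) :
    wedge10 (fun i => (L.comp D) (Pi.single i 1)) (fun i => (L'.comp D) (Pi.single i 1)) =
      (Matrix.of fun k i => D (Pi.single i 1) k).det *
        wedge10 (fun k => L (Pi.single k 1)) (fun k => L' (Pi.single k 1)) := by
  rw [coeff_comp_eq_vecMul L D, coeff_comp_eq_vecMul L' D]
  exact wedge10_vecMul (Matrix.of fun k i => D (Pi.single i 1) k) _ _

/-- Chart independence of the zero locus: where the Jacobian determinant of the chart change is
non-zero, the pulled-back 2-form vanishes at `z` iff the 2-form vanishes at `φ z`. -/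
theorem wedge10_comp_eq_zero_iff (L L' : (Fin 2 → ℂ) →L[ℂ] ℂ)
    {D : (Fin 2 → ℂ) →L[ℂ] (Fin 2 → ℂ)}
    (hD : (Matrix.of fun k i => D (Pi.single i 1) k).det ≠ 0) :
    wedge10 (fun i => (L.comp D) (Pi.single i 1)) (fun i => (L'.comp D) (Pi.single i 1)) = 0 ↔
      wedge10 (fun k => L (Pi.single k 1)) (fun k => L' (Pi.single k 1)) = 0 := by
  rw [wedge10_comp_eq_det_mul, mul_eq_zero, or_iff_right hD]

/-- The differential of a chart change at `z`, as the linear map `D` above: for a map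
`φ : ℂ² → ℂ²` differentiable at `z`, the pull-back of a covector `L` is `L ∘ dφ_z`
(the chain rule, `fderiv_comp`), so the previous statements apply with `D = fderiv ℂ φ z`. -/
theorem fderiv_comp_eq (L : (Fin 2 → ℂ) →L[ℂ] ℂ) {φ : (Fin 2 → ℂ) → (Fin 2 → ℂ)}
    {z : Fin 2 → ℂ} (hφ : DifferentiableAt ℂ φ z) :
    fderiv ℂ (fun w => L (φ w)) z = L.comp (fderiv ℂ φ z) :=
  (L.hasFDerivAt.comp z hφ.hasFDerivAt).fderiv

end ChartChange

end Summit.Ventures.HodgeRepro2.T5FrameIndependence
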